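import Mathlib.Analysis.SpecialFunctions.Pow.Real
import HarnessLib

/-!
# `NoHeavyLowerTail` (stmt-CriticalPhenomena-4575) — real-variable core of the SERIES REDUCTION THEOREM for `E = κ²/(P·m)`:
# `E ≤ C` (C ≥ 1) is preserved when the off-apex graph is glued from two pieces at a cut vertex separating the ports

Support file (prover prim-ineq-gen-8 gen 57; `--supports stmt-CriticalPhenomena-4575`; memo
run/shared/lean/prim/prim-ineq-gen-8/FINDING-gen57-EROUTE.md §0(8), §1).  No definitions, no named facts, no sorries.

Setting of the memo: apex `o`, ports `u, v`, `R = G∖o = R_A ∪ R_B` with `R_A ∩ R_B = {c}`, `u ∈ R_A`, `v ∈ R_B`; `h = 1 − q` the weight of the apex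
edge `oc`.  For the piece `A` (the 3-point configuration `(o∗R_A − oc; u, c)`): `m_A = P(u↔c, o ≁ cluster)`, `p_A = P(o↔u)`, `π_A = P(o↔c)`,
`k_A = κ_A/m_A ≥ 0`; likewise for `B` with ports `(v, c)`.  The composite satisfies EXACTLY (conditioning on the two independent pieces; verified
in exact arithmetic, memo (SER)) `m = m_A q m_B`, `p = p_A + m_A(h + qπ_B)`, `π = p_B + m_B(h + qπ_A)` and `κ/m ≤ h + k_A + k_B`, so that
`E = (κ/m)²·m/(pπ) ≤ C` follows from the inequality below whenever `m_Ak_A² ≤ C p_Aπ_A` and `m_Bk_B² ≤ C p_Bπ_B` (i.e. `E_A, E_B ≤ C`).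
* **`series_core`** — `m_A m_B q (h + k_A + k_B)² ≤ C·(p_A + m_A(h + qπ_B))·(p_B + m_B(h + qπ_A))`. [this work]
-/

namespace Summit.CriticalPhenomena.PercolationContinuityZ3.Theorems

namespace APL

/-- `4x² ≤ s²`, `s ≥ 0` ⟹ `2x ≤ s`. [folklore] -/
private theorem two_mul_le_of_sq {x s : ℝ} (hs : 0 ≤ s) (h : 4 * x ^ 2 ≤ s ^ 2) : 2 * x ≤ s := by
  nlinarith [sq_nonneg (s - 2 * x), sq_nonneg (s + 2 * x), hs]

/-- **Real-variable core of the series reduction.**  For `C ≥ 1`, `0 ≤ q ≤ 1`, `h = 1 − q`, and two pieces with `p, m, π ≥ 0`, `k` real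
and `m·k² ≤ C·p·π` (i.e. `E ≤ C` for the piece), the composite obeys
`m_A m_B q (h + k_A + k_B)² ≤ C (p_A + m_A (h + q π_B)) (p_B + m_B (h + q π_A))` (i.e. `E ≤ C`). [this work] -/
theorem series_core (C q pA mA piA kA pB mB piB kB : ℝ) (hC : 1 ≤ C) (hq0 : 0 ≤ q) (hq1 : q ≤ 1)
    (hpA : 0 ≤ pA) (hmA : 0 ≤ mA) (hpiA0 : 0 ≤ piA) (hypA : mA * kA ^ 2 ≤ C * pA * piA)
    (hpB : 0 ≤ pB) (hmB : 0 ≤ mB) (hpiB0 : 0 ≤ piB) (hypB : mB * kB ^ 2 ≤ C * pB * piB) :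
    mA * mB * q * ((1 - q) + kA + kB) ^ 2 ≤
      C * (pA + mA * ((1 - q) + q * piB)) * (pB + mB * ((1 - q) + q * piA)) := by
  have hC0 : 0 ≤ C := le_trans zero_le_one hC
  have hh : 0 ≤ 1 - q := sub_nonneg.2 hq1
  -- (γ) cross term: 2 q mA mB kA kB ≤ C pA pB + C q² mA mB πA πB
  have cross : 2 * (q * mA * mB * kA * kB) ≤ C * pA * pB + C * q ^ 2 * mA * mB * piA * piB := by
    apply two_mul_le_of_sq
    · nlinarith [mul_nonneg (mul_nonneg hC0 hpA) hpB, mul_nonneg (mul_nonneg (mul_nonneg (mul_nonneg hC0 (sq_nonneg q)) hmA) hmB) (mul_nonneg hpiA0 hpiB0)]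
    · -- (C pA pB + C q² mA mB πA πB)² ≥ 4 C² q² pA πA mA pB πB mB ≥ 4 q² (mA kA)² (mB kB)²
      have h1 : (mA * kA ^ 2) * (mB * kB ^ 2) ≤ (C * pA * piA) * (C * pB * piB) :=
        mul_le_mul hypA hypB (mul_nonneg hmB (sq_nonneg kB)) (mul_nonneg (mul_nonneg hC0 hpA) hpiA0)
      have h2 : 4 * (C * pA * pB) * (C * q ^ 2 * mA * mB * piA * piB) ≤ (C * pA * pB + C * q ^ 2 * mA * mB * piA * piB) ^ 2 := by
        nlinarith [sq_nonneg (C * pA * pB - C * q ^ 2 * mA * mB * piA * piB)]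
      have h3 : 4 * (q * mA * mB * kA * kB) ^ 2 = 4 * q ^ 2 * ((mA * kA ^ 2) * (mB * kB ^ 2)) * (mA * mB) := by ring
      have h4 : 4 * (C * pA * pB) * (C * q ^ 2 * mA * mB * piA * piB) = 4 * q ^ 2 * ((C * pA * piA) * (C * pB * piB)) * (mA * mB) := by ring
      have h5 : 4 * q ^ 2 * ((mA * kA ^ 2) * (mB * kB ^ 2)) * (mA * mB) ≤ 4 * q ^ 2 * ((C * pA * piA) * (C * pB * piB)) * (mA * mB) :=
        mul_le_mul_of_nonneg_right (mul_le_mul_of_nonneg_left h1 (mul_nonneg (by norm_num) (sq_nonneg q))) (mul_nonneg hmA hmB)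
      rw [h3]; rw [h4] at h2; exact h5.trans h2
  -- (ε) 2 q mA kA ≤ pA + C q mA πA  (and the same for B)
  have epsA : 2 * (q * mA * kA) ≤ pA + C * q ^ 2 * mA * piA := by
    apply two_mul_le_of_sq
    · nlinarith [mul_nonneg (mul_nonneg (mul_nonneg hC0 (sq_nonneg q)) hmA) hpiA0]
    · have h2 : 4 * pA * (C * q ^ 2 * mA * piA) ≤ (pA + C * q ^ 2 * mA * piA) ^ 2 := by
        nlinarith [sq_nonneg (pA - C * q ^ 2 * mA * piA)]
      have h3 : 4 * (q * mA * kA) ^ 2 = 4 * q ^ 2 * mA * (mA * kA ^ 2) := by ring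
      have h4 : 4 * q ^ 2 * mA * (mA * kA ^ 2) ≤ 4 * q ^ 2 * mA * (C * pA * piA) :=
        mul_le_mul_of_nonneg_left hypA (mul_nonneg (mul_nonneg (by norm_num) (sq_nonneg q)) hmA)
      have h5 : 4 * q ^ 2 * mA * (C * pA * piA) = 4 * pA * (C * q ^ 2 * mA * piA) := by ring
      rw [h3]; rw [← h5] at h2; exact h4.trans h2
  have epsB : 2 * (q * mB * kB) ≤ pB + C * q ^ 2 * mB * piB := by
    apply two_mul_le_of_sq
    · nlinarith [mul_nonneg (mul_nonneg (mul_nonneg hC0 (sq_nonneg q)) hmB) hpiB0]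
    · have h2 : 4 * pB * (C * q ^ 2 * mB * piB) ≤ (pB + C * q ^ 2 * mB * piB) ^ 2 := by
        nlinarith [sq_nonneg (pB - C * q ^ 2 * mB * piB)]
      have h3 : 4 * (q * mB * kB) ^ 2 = 4 * q ^ 2 * mB * (mB * kB ^ 2) := by ring
      have h4 : 4 * q ^ 2 * mB * (mB * kB ^ 2) ≤ 4 * q ^ 2 * mB * (C * pB * piB) :=
        mul_le_mul_of_nonneg_left hypB (mul_nonneg (mul_nonneg (by norm_num) (sq_nonneg q)) hmB)
      have h5 : 4 * q ^ 2 * mB * (C * pB * piB) = 4 * pB * (C * q ^ 2 * mB * piB) := by ring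
      rw [h3]; rw [← h5] at h2; exact h4.trans h2
  -- (α),(β): q mA mB kA² ≤ C q mB pA πA, q mA mB kB² ≤ C q mA pB πB
  have alphaA : q * mA * mB * kA ^ 2 ≤ C * q * mB * pA * piA := by
    have := mul_le_mul_of_nonneg_left hypA (mul_nonneg hq0 hmB)
    linarith [this]
  have alphaB : q * mA * mB * kB ^ 2 ≤ C * q * mA * pB * piB := by
    have := mul_le_mul_of_nonneg_left hypB (mul_nonneg hq0 hmA)
    linarith [this]
  -- assemble: LHS = L1+…+L6, RHS = B1+…+B6, Li ≤ Bi
  have hq2 : q ^ 2 ≤ q := by nlinarith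
  have d4 : q * mA * mB * (1 - q) ^ 2 ≤ C * mA * mB * (1 - q) ^ 2 := by
    have : q ≤ C := hq1.trans hC
    exact mul_le_mul_of_nonneg_right (mul_le_mul_of_nonneg_right (mul_le_mul_of_nonneg_right this hmA) hmB) (sq_nonneg _)
  have d5 : 2 * (1 - q) * q * mA * mB * kA ≤ C * pA * mB * (1 - q) + C * mA * mB * (1 - q) * q * piA := by
    have e1 := mul_le_mul_of_nonneg_left epsA (mul_nonneg hh hmB)
    have f1 : (1 - q) * mB * pA ≤ C * pA * mB * (1 - q) := by nlinarith [mul_nonneg (mul_nonneg hh hmB) hpA, mul_nonneg (sub_nonneg.2 hC) (mul_nonneg (mul_nonneg hh hmB) hpA)]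
    have f2 : (1 - q) * mB * (C * q ^ 2 * mA * piA) ≤ C * mA * mB * (1 - q) * q * piA := by
      have := mul_le_mul_of_nonneg_left hq2 (mul_nonneg (mul_nonneg (mul_nonneg (mul_nonneg hC0 hmA) hmB) hh) hpiA0)
      linarith [this]
    linarith [e1, f1, f2]
  have d6 : 2 * (1 - q) * q * mA * mB * kB ≤ C * pB * mA * (1 - q) + C * mA * mB * (1 - q) * q * piB := by
    have e2 := mul_le_mul_of_nonneg_left epsB (mul_nonneg hh hmA)
    have f1 : (1 - q) * mA * pB ≤ C * pB * mA * (1 - q) := by nlinarith [mul_nonneg (mul_nonneg hh hmA) hpB, mul_nonneg (sub_nonneg.2 hC) (mul_nonneg (mul_nonneg hh hmA) hpB)]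
    have f2 : (1 - q) * mA * (C * q ^ 2 * mB * piB) ≤ C * mA * mB * (1 - q) * q * piB := by
      have := mul_le_mul_of_nonneg_left hq2 (mul_nonneg (mul_nonneg (mul_nonneg (mul_nonneg hC0 hmA) hmB) hh) hpiB0)
      linarith [this]
    linarith [e2, f1, f2]
  have eL : mA * mB * q * ((1 - q) + kA + kB) ^ 2 =
      q * mA * mB * kA ^ 2 + q * mA * mB * kB ^ 2 + 2 * (q * mA * mB * kA * kB) + q * mA * mB * (1 - q) ^ 2
        + 2 * (1 - q) * q * mA * mB * kA + 2 * (1 - q) * q * mA * mB * kB := by ring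
  have eR : C * (pA + mA * ((1 - q) + q * piB)) * (pB + mB * ((1 - q) + q * piA)) =
      C * q * mB * pA * piA + C * q * mA * pB * piB + (C * pA * pB + C * q ^ 2 * mA * mB * piA * piB) + C * mA * mB * (1 - q) ^ 2
        + (C * pA * mB * (1 - q) + C * mA * mB * (1 - q) * q * piA) + (C * pB * mA * (1 - q) + C * mA * mB * (1 - q) * q * piB) := by ring
  rw [eL, eR]
  linarith [alphaA, alphaB, cross, d4, d5, d6]

end APL

end Summit.CriticalPhenomena.PercolationContinuityZ3.Theorems
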